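import Summits.ABC.ABC.Theorems.TwistAmplificationSharpModerateLawReduction
import Summits.ABC.ABC.Theorems.TwistAmplificationSharpModerateLawFreyPairs

/-!
# Crux `TwistAmplification.SharpModerateLaw` (stmt-ABC-1975), line `syzygy-lattice-half-deep-few-primes`:
the line's open core dominates the Mazur–Kane law (calibration of the promoted stub)

The line reduces the crux to `btt_uniformity_sqDvd → SpreadLawCone → SharpModerateLaw` through the
cone-restricted cusp shell law `CuspShellLawCone` (`…Reduction.lean`, `…SyzygyTransferCone.lean`).
This file certifies how strong that typed intermediate is: **`CuspShellLawCone` implies the route's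
rank-4 crux `MazurKaneLaw`** (stmt-ABC-2757: for `1 < s < 2`, the abc triples with `c ≤ N` and
`rad(abc) ≤ c^s` number `≪_ε N^{s−1+ε}` — the upper half of Mazur's question, open below Kane's
`N^{1+ε}`), unconditionally and with no tail: the untwisted Frey curve `y² = x(x−a)(x+b)` of a triple
has cusp coordinates

  `x(a,b) = (c₄, c₆) = (16(a²+ab+b²), −32(b−a)(2a+b)(a+2b))`, `c₄³ − c₆² = 1728·16(abc)²`,

which are tower-free (`TF`: no prime divides both `a²+ab+b²` and `ab(a+b)`, and only `3` can divide
both `a²+ab+b²` and `(b−a)(2a+b)(a+2b)`), have conductor proxy `N5cusp ≤ rad(abc) ≤ c^s`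
(multiplicative at every `p ≥ 5`) and level `Mcusp = (16(a²+ab+b²))³ ∈ (27N⁶, 4096N⁶]` for
`c ∈ (N/2, N]`, i.e. they lie in one of the `8` dyadic shells `cuspShell N^s (27N⁶·2ⁱ)`, `i < 8`, all
inside the cone `X³ ≤ 2Y ≤ 2X^7` once `N ≥ 3456`; the map is injective on triples (`c³ − (a²+ab+b²)c =
abc` is increasing in `c`).  So the dyadic block `c ∈ (N/2, N]` has `≤ 16·C·3456^{ε/8}·N^{s−1+ε}`
triples and a halving induction on `N` gives `MazurKaneLaw`.

The Frey-pair facts (syzygy, `TF`, `N5cusp ≤ rad`, `Mcusp = (16A)³` and its bounds, injectivity) are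
support file 1/2, `TwistAmplificationSharpModerateLawFreyPairs.lean`; this file 2/2 does the counting.

Consequences recorded here: `IndexFormShellLawCone → MazurKaneLaw` (through the landed dictionary step
`syzygyTransferCone`) and `btt_uniformity_sqDvd → SpreadLawCone → MazurKaneLaw` (through the landed
few-deep law and cone split) — the statement promoted from this line (`SpreadLawCone`, registered stub
`stub_spreadCensusCone`) is, modulo the BTT uniformity fact, at least as strong as BOTH open cruxes
`SharpModerateLaw` and `MazurKaneLaw` of the route.
-/

noncomputable section

namespace Summit.ABC.ABC.Theorems.SharpModerateLaw

open Literature.NumberTheory.DiophantineGeometry (IsABCTriple rad)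
open Summit.ABC.ABC.Theses.TwistAmplification (MazurKaneLaw)
open Finset

/-! ## 1. The counted sets of the Mazur–Kane law and the halving step -/

/-- The set counted by `MazurKaneLaw` at `(s, N)`: abc triples `(a, b, c)` with `c ≤ N` and
`rad(abc) ≤ c^s` (verbatim the set of the route decl). -/
def mkSet (s : ℝ) (N : ℕ) : Set (ℕ × ℕ × ℕ) :=
  {t | IsABCTriple t.1 t.2.1 t.2.2 ∧ t.2.2 ≤ N ∧ ((rad t.1 t.2.1 t.2.2 : ℕ) : ℝ) ≤ (t.2.2 : ℝ) ^ s}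

/-- The dyadic block `c ∈ (N/2, N]` of `mkSet s N`. -/
def mkBlock (s : ℝ) (N : ℕ) : Set (ℕ × ℕ × ℕ) :=
  {t | t ∈ mkSet s N ∧ N < 2 * t.2.2}

/-- `mkSet s N` is finite (`a, b, c ≤ N`). -/
theorem mkSet_finite (s : ℝ) (N : ℕ) : (mkSet s N).Finite := by
  refine ((Set.finite_Iic N).prod ((Set.finite_Iic N).prod (Set.finite_Iic N))).subset ?_
  rintro ⟨a, b, c⟩ ⟨⟨-, -, hsum, -⟩, hcN, -⟩
  simp only [Set.mem_prod, Set.mem_Iic]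
  simp only at hsum hcN
  omega

/-- `mkBlock s N` is finite. -/
theorem mkBlock_finite (s : ℝ) (N : ℕ) : (mkBlock s N).Finite :=
  (mkSet_finite s N).subset fun _ ht => ht.1

/-- Trivial bound: `#mkSet s N ≤ (N+1)²` (`(a, b)` determine the triple). -/
theorem ncard_mkSet_le_sq (s : ℝ) (N : ℕ) : (mkSet s N).ncard ≤ (N + 1) ^ 2 := by
  have h := Set.ncard_le_ncard_of_injOn
    (t := ((Finset.range (N + 1) ×ˢ Finset.range (N + 1) : Finset (ℕ × ℕ)) : Set (ℕ × ℕ)))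
    (s := mkSet s N) (fun t : ℕ × ℕ × ℕ => (t.1, t.2.1)) ?_ ?_ (Finset.finite_toSet _)
  · simpa [Set.ncard_coe_finset, Finset.card_product, sq] using h
  · rintro ⟨a, b, c⟩ ⟨⟨-, -, hsum, -⟩, hcN, -⟩
    simp only at hsum hcN
    simp only [Finset.coe_product, Set.mem_prod, Finset.mem_coe, Finset.mem_range]
    omega
  · rintro ⟨a, b, c⟩ ⟨⟨-, -, hsum, -⟩, -, -⟩ ⟨a', b', c'⟩ ⟨⟨-, -, hsum', -⟩, -, -⟩ h
    simp only [Prod.mk.injEq] at h hsum hsum' ⊢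
    omega

/-- The halving step: `#mkSet s N ≤ #mkSet s ⌊N/2⌋ + #mkBlock s N`. -/
theorem ncard_mkSet_le_half (s : ℝ) (N : ℕ) :
    (mkSet s N).ncard ≤ (mkSet s (N / 2)).ncard + (mkBlock s N).ncard := by
  have hsub : mkSet s N ⊆ mkSet s (N / 2) ∪ mkBlock s N := by
    intro t ht
    by_cases h : N < 2 * t.2.2
    · exact Or.inr ⟨ht, h⟩
    · refine Or.inl ⟨ht.1, ?_, ht.2.2⟩
      have : 2 * t.2.2 ≤ N := not_lt.mp h
      omega
  exact (Set.ncard_le_ncard hsub ((mkSet_finite s _).union (mkBlock_finite s N))).trans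
    (Set.ncard_union_le _ _)

/-! ## 2. A block triple lands in one of eight dyadic cusp shells -/

/-- For `t = (a,b,c) ∈ mkBlock s N` (`N ≥ 4`), the Frey pair lies in `cuspShell N^s (27N⁶·2ⁱ)` for
some `i < 8`. -/
theorem freyPair_mem_iUnion_cuspShell {s : ℝ} (hs0 : 0 ≤ s) {N : ℕ} (hN : 4 ≤ N) {t : ℕ × ℕ × ℕ}
    (ht : t ∈ mkBlock s N) :
    freyPair t.1 t.2.1 ∈ ⋃ i : Fin 8, cuspShell ((N : ℝ) ^ s) (27 * (N : ℝ) ^ 6 * 2 ^ (i : ℕ)) := by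
  obtain ⟨a, b, c⟩ := t
  obtain ⟨⟨⟨ha, hb, hsum, hcop⟩, hcN, hrad⟩, hNc⟩ := ht
  simp only at ha hb hsum hcop hcN hrad hNc ⊢
  subst hsum
  obtain ⟨hlo, hhi⟩ := mcusp_freyPair_bounds ha hb hcN hNc
  set m : ℝ := (Mcusp (freyPair a b) : ℝ) with hm
  set Y₀ : ℝ := 27 * (N : ℝ) ^ 6 with hY₀
  have hN1 : (1 : ℝ) ≤ N := by exact_mod_cast (show 1 ≤ N by omega)
  have hY₀pos : 0 < Y₀ := by rw [hY₀]; positivity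
  have hr : 1 ≤ m / Y₀ := (one_le_div hY₀pos).mpr hlo.le
  obtain ⟨n, hn1, hn2⟩ := exists_nat_pow_near hr one_lt_two
  have hn8 : n < 8 := by
    have h256 : m / Y₀ < (2 : ℝ) ^ 8 := by
      rw [div_lt_iff₀ hY₀pos, hY₀]; nlinarith [hhi]
    exact (pow_lt_pow_iff_right₀ one_lt_two).mp (hn1.trans_lt h256)
  refine Set.mem_iUnion.mpr ⟨⟨n, hn8⟩, ?_⟩
  have hab : a ≠ b := by
    rintro rfl
    have : a = 1 := by simpa [Nat.Coprime] using hcop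
    subst this
    omega
  have haZ : (0 : ℤ) < a := by exact_mod_cast ha
  have hbZ : (0 : ℤ) < b := by exact_mod_cast hb
  have hAZ : 0 < freyA a b := by unfold freyA; positivity
  show freyPair a b ∈ {x : ℤ × ℤ | _}
  simp only [Set.mem_setOf_eq]
  refine ⟨?_, ?_, ?_, ⟨16 * ((a : ℤ) * b * (a + b)) ^ 2, freyPair_cube_sub_sq a b⟩, tf_freyPair hcop,
    ?_, ?_, ?_⟩
  · rw [freyPair_fst]; positivity
  · rw [freyPair_snd]
    have h1 : (b : ℤ) - a ≠ 0 := sub_ne_zero.mpr (by exact_mod_cast hab.symm)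
    have h2 : (2 * (a : ℤ) + b) ≠ 0 := by positivity
    have h3 : ((a : ℤ) + 2 * b) ≠ 0 := by positivity
    exact mul_ne_zero (mul_ne_zero (mul_ne_zero (by norm_num) h1) h2) h3
  · intro h
    have e := freyPair_cube_sub_sq a b
    rw [h, sub_self] at e
    have : (0 : ℤ) < 1728 * (16 * ((a : ℤ) * b * (a + b)) ^ 2) := by positivity
    linarith
  · -- `Y ≤ Mcusp`
    show Y₀ * 2 ^ n ≤ m
    rwa [← le_div_iff₀' hY₀pos]
  · -- `Mcusp < 2Y`
    show m < 2 * (Y₀ * 2 ^ n)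
    have : m / Y₀ < 2 ^ (n + 1) := hn2
    rw [div_lt_iff₀' hY₀pos] at this
    calc m < Y₀ * 2 ^ (n + 1) := this
      _ = 2 * (Y₀ * 2 ^ n) := by ring
  · -- `N5cusp ≤ rad ≤ c^s ≤ N^s`
    have h1 : (N5cusp (freyPair a b) : ℝ) ≤ (rad a b (a + b) : ℝ) := by
      exact_mod_cast n5cusp_freyPair_le_rad ha hb hcop
    have h2 : (((a + b : ℕ) : ℝ)) ^ s ≤ (N : ℝ) ^ s :=
      Real.rpow_le_rpow (Nat.cast_nonneg _) (by exact_mod_cast hcN) hs0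
    exact h1.trans (hrad.trans h2)

/-! ## 3. The block bound and the halving induction -/

/-- **Block bound.** Under `CuspShellLawCone`: for `1 < s < 2`, `ε > 0` there is `K ≥ 0` with
`#mkBlock s N ≤ K · N^{s−1+ε}` for all `N ≥ 3456` (eight dyadic shells at `X = N^s`, `Y = 27N⁶2ⁱ`,
`σ = 7`, `ε/8`). -/
theorem ncard_mkBlock_le (hlaw : CuspShellLawCone) {s ε : ℝ} (hs1 : 1 < s) (hs2 : s < 2) (hε : 0 < ε) :
    ∃ K : ℝ, 0 ≤ K ∧ ∀ N : ℕ, 3456 ≤ N → ((mkBlock s N).ncard : ℝ) ≤ K * (N : ℝ) ^ (s - 1 + ε) := by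
  obtain ⟨C₀, hC₀⟩ := hlaw 7 (by norm_num) (ε / 8) (by positivity)
  set C : ℝ := max C₀ 0 with hC
  have hC0 : 0 ≤ C := le_max_right _ _
  have hCC : C₀ ≤ C := le_max_left _ _
  refine ⟨16 * C * (3456 : ℝ) ^ (ε / 8), by positivity, fun N hN => ?_⟩
  have hs0 : 0 ≤ s := by linarith
  have hN1 : (1 : ℝ) ≤ N := by exact_mod_cast (show 1 ≤ N by omega)
  have hN0 : (0 : ℝ) ≤ N := by linarith
  have hNpos : (0 : ℝ) < N := by linarith
  have hN3456 : (3456 : ℝ) ≤ N := by exact_mod_cast hN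
  set X : ℝ := (N : ℝ) ^ s with hX
  set Y₀ : ℝ := 27 * (N : ℝ) ^ 6 with hY₀
  have hX1 : 1 ≤ X := Real.one_le_rpow hN1 hs0
  have hX0 : 0 ≤ X := by linarith
  have hN6 : (1 : ℝ) ≤ (N : ℝ) ^ 6 := one_le_pow₀ hN1
  have hY₀1 : 1 ≤ Y₀ := by rw [hY₀]; linarith
  have hY₀pos : 0 < Y₀ := by linarith
  -- rpow bookkeeping at base `N`
  have hX3 : X ^ 3 ≤ (N : ℝ) ^ 6 := by
    have e : X ^ 3 = (N : ℝ) ^ (s * 3) := by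
      rw [hX, ← Real.rpow_natCast ((N : ℝ) ^ s) 3, ← Real.rpow_mul hN0]; norm_num
    rw [e, show ((N : ℝ) ^ 6) = (N : ℝ) ^ ((6 : ℕ) : ℝ) from (Real.rpow_natCast _ 6).symm]
    exact Real.rpow_le_rpow_of_exponent_le hN1 (by push_cast; linarith)
  have hX7 : 3456 * (N : ℝ) ^ 6 ≤ X ^ (7 : ℝ) := by
    have e : X ^ (7 : ℝ) = (N : ℝ) ^ (s * 7) := by rw [hX, ← Real.rpow_mul hN0]
    have h7 : (N : ℝ) ^ ((7 : ℕ) : ℝ) ≤ (N : ℝ) ^ (s * 7) :=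
      Real.rpow_le_rpow_of_exponent_le hN1 (by push_cast; linarith)
    rw [Real.rpow_natCast] at h7
    rw [e]
    calc 3456 * (N : ℝ) ^ 6 ≤ (N : ℝ) * (N : ℝ) ^ 6 := by gcongr
      _ = (N : ℝ) ^ 7 := by ring
      _ ≤ _ := h7
  have hX2 : X ≤ (N : ℝ) ^ 2 := by
    have h := Real.rpow_le_rpow_of_exponent_le hN1 hs2.le
    rwa [show ((N : ℝ) ^ (2 : ℝ)) = (N : ℝ) ^ 2 from by exact_mod_cast Real.rpow_natCast (N : ℝ) 2] at h
  have hNinv : ((N : ℝ) ^ 6) ^ (-(1 / 6 : ℝ)) = (N : ℝ) ^ (-1 : ℝ) := by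
    rw [← Real.rpow_natCast (N : ℝ) 6, ← Real.rpow_mul hN0]; norm_num
  have hXs1 : X * (N : ℝ) ^ (-1 : ℝ) = (N : ℝ) ^ (s - 1) := by
    rw [hX, ← Real.rpow_add hNpos]; ring_nf
  have hNε : ((N : ℝ) ^ 8) ^ (ε / 8) = (N : ℝ) ^ ε := by
    rw [← Real.rpow_natCast (N : ℝ) 8, ← Real.rpow_mul hN0]; ring_nf
  have h1le : (1 : ℝ) ≤ (N : ℝ) ^ (s - 1) := Real.one_le_rpow hN1 (by linarith)
  have hθ : (N : ℝ) ^ ε * (N : ℝ) ^ (s - 1) = (N : ℝ) ^ (s - 1 + ε) := by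
    rw [← Real.rpow_add hNpos]; ring_nf
  -- the shells
  set S : Fin 8 → Set (ℤ × ℤ) := fun i => cuspShell X (Y₀ * 2 ^ (i : ℕ)) with hS
  have hfin : ∀ i : Fin 8, (S i).Finite := fun i => cuspShell_finite _ _
  -- Step 1: the block injects into the union of the shells
  have step1 : (mkBlock s N).ncard ≤ (⋃ i : Fin 8, S i).ncard := by
    refine Set.ncard_le_ncard_of_injOn (fun t => freyPair t.1 t.2.1) (fun t ht => ?_) ?_
      (Set.finite_iUnion hfin)
    · exact freyPair_mem_iUnion_cuspShell hs0 (by omega) ht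
    · rintro ⟨a, b, c⟩ ⟨⟨⟨ha, hb, hsum, -⟩, -, -⟩, -⟩ ⟨a', b', c'⟩ ⟨⟨⟨ha', hb', hsum', -⟩, -, -⟩, -⟩ h
      simp only at ha hb hsum ha' hb' hsum' h
      obtain ⟨h1, h2⟩ := freyPair_inj ha hb ha' hb' h
      subst h1 h2 hsum hsum'
      rfl
  -- Step 2: union ≤ sum
  have step2 : (⋃ i : Fin 8, S i).ncard ≤ ∑ i : Fin 8, (S i).ncard := Set.ncard_iUnion_le_of_fintype S
  -- Step 3: each shell
  have step3 : ∀ i : Fin 8, ((S i).ncard : ℝ) ≤ 2 * C * (3456 : ℝ) ^ (ε / 8) * (N : ℝ) ^ (s - 1 + ε) := by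
    intro i
    have hi : (i : ℕ) ≤ 7 := Nat.lt_succ_iff.mp i.isLt
    set Y : ℝ := Y₀ * 2 ^ (i : ℕ) with hY
    have h2i : (1 : ℝ) ≤ 2 ^ (i : ℕ) := one_le_pow₀ one_le_two
    have h2i' : (2 : ℝ) ^ (i : ℕ) ≤ 2 ^ 7 := pow_le_pow_right₀ one_le_two hi
    have hYY₀ : Y₀ ≤ Y := by rw [hY]; nlinarith
    have hY128 : Y ≤ 128 * Y₀ := by rw [hY]; nlinarith
    have hY1 : 1 ≤ Y := hY₀1.trans hYY₀
    have hYpos : 0 < Y := by linarith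
    have hcone1 : X ^ 3 ≤ 2 * Y := by nlinarith [hX3, hN6]
    have hcone2 : Y ≤ X ^ (7 : ℝ) := by nlinarith [hX7]
    have hlawi := hC₀ X Y hX1 hY1 hcone1 hcone2
    -- `(XY)^{ε/8} ≤ 3456^{ε/8} N^ε`
    have hXY : (X * Y) ^ (ε / 8) ≤ (3456 : ℝ) ^ (ε / 8) * (N : ℝ) ^ ε := by
      have hle : X * Y ≤ 3456 * (N : ℝ) ^ 8 := by
        calc X * Y ≤ (N : ℝ) ^ 2 * (128 * Y₀) := by gcongr
          _ = 3456 * (N : ℝ) ^ 8 := by rw [hY₀]; ring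
      calc (X * Y) ^ (ε / 8) ≤ (3456 * (N : ℝ) ^ 8) ^ (ε / 8) :=
            Real.rpow_le_rpow (by positivity) hle (by positivity)
        _ = (3456 : ℝ) ^ (ε / 8) * ((N : ℝ) ^ 8) ^ (ε / 8) := Real.mul_rpow (by norm_num) (by positivity)
        _ = _ := by rw [hNε]
    -- `X Y^{-1/6} ≤ N^{s-1}`
    have hmain : X * Y ^ (-(1 / 6 : ℝ)) ≤ (N : ℝ) ^ (s - 1) := by
      have h1 : Y ^ (-(1 / 6 : ℝ)) ≤ ((N : ℝ) ^ 6) ^ (-(1 / 6 : ℝ)) :=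
        Real.rpow_le_rpow_of_nonpos (by positivity) (by rw [hY₀] at hYY₀; nlinarith) (by norm_num)
      rw [hNinv] at h1
      calc X * Y ^ (-(1 / 6 : ℝ)) ≤ X * (N : ℝ) ^ (-1 : ℝ) := by gcongr
        _ = _ := hXs1
    have hE : 0 ≤ (X * Y) ^ (ε / 8) := Real.rpow_nonneg (by positivity) _
    have hA : 0 ≤ X * Y ^ (-(1 / 6 : ℝ)) := by positivity
    calc ((S i).ncard : ℝ) ≤ C₀ * (X * Y) ^ (ε / 8) * (X * Y ^ (-(1 / 6 : ℝ)) + 1) := hlawi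
      _ ≤ C * (X * Y) ^ (ε / 8) * (X * Y ^ (-(1 / 6 : ℝ)) + 1) := by gcongr
      _ ≤ C * ((3456 : ℝ) ^ (ε / 8) * (N : ℝ) ^ ε) * ((N : ℝ) ^ (s - 1) + (N : ℝ) ^ (s - 1)) := by
          gcongr
      _ = 2 * C * (3456 : ℝ) ^ (ε / 8) * ((N : ℝ) ^ ε * (N : ℝ) ^ (s - 1)) := by ring
      _ = _ := by rw [hθ]
  -- assemble
  calc ((mkBlock s N).ncard : ℝ) ≤ ((⋃ i : Fin 8, S i).ncard : ℝ) := by exact_mod_cast step1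
    _ ≤ ((∑ i : Fin 8, (S i).ncard : ℕ) : ℝ) := by exact_mod_cast step2
    _ = ∑ i : Fin 8, ((S i).ncard : ℝ) := by push_cast; rfl
    _ ≤ ∑ _i : Fin 8, 2 * C * (3456 : ℝ) ^ (ε / 8) * (N : ℝ) ^ (s - 1 + ε) := Finset.sum_le_sum fun i _ => step3 i
    _ = 16 * C * (3456 : ℝ) ^ (ε / 8) * (N : ℝ) ^ (s - 1 + ε) := by
          rw [Finset.sum_const, Finset.card_univ, Fintype.card_fin]; simp; ring

/-- **The count**, by halving induction on `N`: `#mkSet s N ≤ C · N^{s−1+ε}` for `N ≥ 2`. -/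
theorem ncard_mkSet_le (hlaw : CuspShellLawCone) {s ε : ℝ} (hs1 : 1 < s) (hs2 : s < 2) (hε : 0 < ε) :
    ∃ C : ℝ, ∀ N : ℕ, 2 ≤ N → ((mkSet s N).ncard : ℝ) ≤ C * (N : ℝ) ^ (s - 1 + ε) := by
  obtain ⟨K, hK0, hK⟩ := ncard_mkBlock_le hlaw hs1 hs2 hε
  set θ : ℝ := s - 1 + ε with hθdef
  have hθ : 0 < θ := by rw [hθdef]; linarith
  set q : ℝ := (2 : ℝ) ^ θ with hq
  have hq1 : 1 < q := Real.one_lt_rpow one_lt_two hθ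
  have hqpos : 0 < q := by linarith
  set K₁ : ℝ := K * q / (q - 1) with hK₁
  have hK₁0 : 0 ≤ K₁ := by rw [hK₁]; exact div_nonneg (by positivity) (by linarith)
  set K₂ : ℝ := ((3456 : ℝ) + 1) ^ 2 with hK₂
  have hK₂0 : 0 ≤ K₂ := by positivity
  have halg : K₁ / q + K = K₁ := by
    have hq' : q - 1 ≠ 0 := ne_of_gt (by linarith)
    rw [hK₁]; field_simp; ring
  have key : ∀ N : ℕ, ((mkSet s N).ncard : ℝ) ≤ K₁ * (N : ℝ) ^ θ + K₂ := by
    intro N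
    induction N using Nat.strong_induction_on with
    | _ N ih =>
      have hNθ : 0 ≤ K₁ * (N : ℝ) ^ θ := mul_nonneg hK₁0 (Real.rpow_nonneg (Nat.cast_nonneg N) θ)
      rcases lt_or_ge N 3456 with hlt | hge
      · have h := ncard_mkSet_le_sq s N
        have h' : ((mkSet s N).ncard : ℝ) ≤ ((N : ℝ) + 1) ^ 2 := by exact_mod_cast h
        have h'' : ((N : ℝ) + 1) ^ 2 ≤ K₂ := by
          rw [hK₂]; gcongr; exact_mod_cast hlt.le
        linarith
      · have hhalf : ((mkSet s N).ncard : ℝ) ≤ ((mkSet s (N / 2)).ncard : ℝ) + ((mkBlock s N).ncard : ℝ) := by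
          exact_mod_cast ncard_mkSet_le_half s N
        have ih' := ih (N / 2) (Nat.div_lt_self (by omega) one_lt_two)
        have hb := hK N hge
        have hdiv : (((N / 2 : ℕ) : ℝ)) ^ θ ≤ ((N : ℝ) / 2) ^ θ :=
          Real.rpow_le_rpow (Nat.cast_nonneg _) Nat.cast_div_le hθ.le
        have hsplit : ((N : ℝ) / 2) ^ θ = (N : ℝ) ^ θ / q := by
          rw [hq, Real.div_rpow (Nat.cast_nonneg N) zero_le_two]
        calc ((mkSet s N).ncard : ℝ)
            ≤ (K₁ * (((N / 2 : ℕ) : ℝ)) ^ θ + K₂) + K * (N : ℝ) ^ θ := by linarith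
          _ ≤ (K₁ * (((N : ℝ) / 2) ^ θ) + K₂) + K * (N : ℝ) ^ θ := by gcongr
          _ = (K₁ / q + K) * (N : ℝ) ^ θ + K₂ := by rw [hsplit]; ring
          _ = K₁ * (N : ℝ) ^ θ + K₂ := by rw [halg]
  refine ⟨K₁ + K₂, fun N hN => ?_⟩
  have h1 : (1 : ℝ) ≤ (N : ℝ) ^ θ := Real.one_le_rpow (by exact_mod_cast (show 1 ≤ N by omega)) hθ.le
  calc ((mkSet s N).ncard : ℝ) ≤ K₁ * (N : ℝ) ^ θ + K₂ := key N
    _ ≤ K₁ * (N : ℝ) ^ θ + K₂ * (N : ℝ) ^ θ := by nlinarith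
    _ = (K₁ + K₂) * (N : ℝ) ^ θ := by ring

/-! ## 4. The calibration theorems -/

/-- **The cone-restricted cusp shell law implies the Mazur–Kane law** (route crux stmt-ABC-2757,
`MazurKaneLaw`: `#{abc triples, c ≤ N, rad(abc) ≤ c^s} ≤ C(s,ε)·N^{s−1+ε}` for `1 < s < 2`).
Registered sub-goal `mazurKaneLaw_of_cuspShellLawCone` of stmt-ABC-1975 (calibration of the promoted open core). -/
theorem mazurKaneLaw_of_cuspShellLawCone : CuspShellLawCone → Summit.ABC.ABC.Theses.TwistAmplification.MazurKaneLaw := by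
  intro hlaw s hs1 hs2 ε hε
  obtain ⟨C, hC⟩ := ncard_mkSet_le hlaw hs1 hs2 hε
  exact ⟨C, fun N hN => hC N hN⟩

/-- The unrestricted cusp shell law implies the Mazur–Kane law. -/
theorem mazurKaneLaw_of_cuspShellLaw (h : CuspShellLaw) : MazurKaneLaw :=
  mazurKaneLaw_of_cuspShellLawCone (cuspShellLawCone_of_cuspShellLaw h)

/-- The cone-restricted index-form shell law implies the Mazur–Kane law (through the landed dictionary
step `syzygyTransferCone`). -/
theorem mazurKaneLaw_of_indexFormShellLawCone (h : IndexFormShellLawCone) : MazurKaneLaw :=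
  mazurKaneLaw_of_cuspShellLawCone (syzygyTransferCone h)

/-- **Calibration of the promoted stub.** The BTT uniformity fact and the line's open core
`SpreadLawCone` (registered stub `stub_spreadCensusCone`) imply the Mazur–Kane law — so, with
`sharpModerateLaw_of_uniformity_of_spreadLawCone`, the promoted statement dominates BOTH open cruxes
`SharpModerateLaw` (stmt-ABC-1975) and `MazurKaneLaw` (stmt-ABC-2757) of the route. -/
theorem mazurKaneLaw_of_uniformity_of_spreadLawCone
    (hU : Literature.NumberTheory.CubicFields.btt_uniformity_sqDvd) (hSp : SpreadLawCone) : MazurKaneLaw :=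
  mazurKaneLaw_of_indexFormShellLawCone
    (indexFormShellLawCone_of_split (fewDeepLawCone_of_fewDeepLaw (fewDeepLaw_of_uniformity hU)) hSp)


end Summit.ABC.ABC.Theorems.SharpModerateLaw

end
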